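import Literature.AlgebraicGeometry.HodgeTheory.GAGADifferentialFormsProjectiveSpace
import Literature.Algebra.Homology.SerreVanishing
import HarnessLib

/-!
# `Ω^p_{ℙ_r}` as a graded module: the Koszul presentation, gradedness, and Serre's vanishing
# theorem for `Ω^p(n)` — algebraic and, by GAGA, holomorphic

The graded kernel module `Z_p = GAGAForms.Zsub r p ⊆ P^{Sub p}` (whose associated sheaf on
`ℙ_r = Proj P` is `Ω^p_{ℙ_r}`, Okonek–Schneider–Spindler Ch. I §1.1 (3)) was defined in
`GAGADifferentialFormsProjectiveSpace.lean` through the Laurent side. This file identifies it with the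
KERNEL OF A DEGREE-ZERO `P`-LINEAR MAP OF FREE GRADED MODULES — the polynomial Koszul differential
`KoszulCech.kd (fun i => X i) q : P(-q-1)^{Sub (q+1)} → P(-q)^{Sub q}` — so that the tree's graded-module theory
(`Literature/Algebra/Homology/LaurentCechExact`, `SerreFiniteness`, `SerreVanishing`) applies to it:

* `ιK_kdP` (compatibility of the polynomial and Laurent Koszul differentials with `toL`),
  `Zsub_succ` (`Z_{q+1} = ker ∂_P`),
  `isDegZero_kdP` (the Koszul differential is graded of degree zero: its matrix entries are `±x_i`),
  **`isGraded_Zsub`**;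
* **`GAGAForms.exists_forall_isZero_homology_cech_Zsub` — Serre's vanishing theorem for `Ω^p(n)`**,
  algebraic Čech form: there is `n₀` with `Hᵃ(Č_n(Z_p)) = 0` for all `n ≥ n₀`, `a ≥ 1` (Hartshorne III
  Thm. 5.2 (b) / Serre FAC for the coherent sheaf `Ω^p`, through the tree's
  `LaurentCech.exists_forall_isZero_homology_cech` for graded submodules);
* **`GAGAForms.exists_forall_isZero_homology_holCech`** — the same for the holomorphic Čech
  cohomology `Ȟᵃ(𝔘^h, Ω^p(n)^h)`, transported along GAGA Théorème 1
  (`GAGAForms.isIso_homologyMap_cechComparison`).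

Theorems only; no named facts.

## References
* [Hartshorne1977] R. Hartshorne, *Algebraic Geometry*, III Thm. 5.2 (b) (Serre: `H^i(X, 𝓕(n)) = 0`
  for `i > 0`, `n ≫ 0`).
* [SerreGAGA1956] J.-P. Serre, *Géométrie algébrique et géométrie analytique* (1956), n° 12 Thm. 1.
* [OkonekSchneiderSpindler1980] C. Okonek, M. Schneider, H. Spindler, *Vector Bundles on Complex
  Projective Spaces*, Ch. I §1.1 (3).
* [GortzWedhorn2023] U. Görtz, T. Wedhorn, *Algebraic Geometry II*, (19.1) Def. 19.1.
-/

noncomputable section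

open CategoryTheory CategoryTheory.Limits Finset

namespace Literature.AlgebraicGeometry.HodgeTheory

namespace GAGAForms

open Literature.Algebra.Homology Literature.Algebra.Homology.LaurentCech
  Literature.Algebra.Homology.OrderedCech Literature.Algebra.Homology.KoszulCech GAGATwist

variable {r : ℕ}

/-! ### The polynomial Koszul differential -/

/-- `toL` maps the sign `ε(s, a) ∈ P` to the sign in `L`. [cite: GortzWedhorn2023, Def. 21.68] -/
theorem toL_sign (s : Finset (Fin (r + 1))) (a : Fin (r + 1)) :
    toL ℂ r (OrderedCech.sign (P ℂ r) s a) = OrderedCech.sign (L ℂ r) s a := by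
  unfold OrderedCech.sign
  rw [map_pow, map_neg, map_one]

/-- **`ι ∘ ∂_P = ∂_L ∘ ι`**: the polynomial Koszul differential is the restriction of the Laurent one.
[cite: GortzWedhorn2023, Rem. 19.5 (4)] -/
theorem ιK_kdP (q : ℕ) (v : Sub (Fin (r + 1)) (q + 1) → P ℂ r) :
    ιK ℂ r _ (kd (M := P ℂ r) (fun i : Fin (r + 1) => (MvPolynomial.X i : P ℂ r)) q v) =
      kd (M := L ℂ r) (xL r) q (ιK ℂ r _ v) := by
  funext I
  rw [ιK_apply, kd_apply, kd_apply, map_sum]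
  refine Finset.sum_congr rfl fun i _ => ?_
  rw [smul_eq_mul, smul_eq_mul, map_mul, map_mul, toL_sign, xL_eq_toL]
  congr 1
  by_cases h : (insert i I.1).card = q + 1
  · rw [extL_apply_of_eq h, extL_apply_of_eq h, ιK_apply]
  · rw [extL_apply_of_ne h, extL_apply_of_ne h, map_zero]

/-- **`Z_{q+1} = ker (∂ : P^{Sub (q+1)} → P^{Sub q})`.** [cite: OkonekSchneiderSpindler1980, Ch. I §1.1 (3)] -/
theorem Zsub_succ (q : ℕ) :
    Zsub r (q + 1) = LinearMap.ker (kd (M := P ℂ r) (fun i : Fin (r + 1) => (MvPolynomial.X i : P ℂ r)) q) := by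
  ext k
  rw [mem_Zsub, mem_cycles_succ, LinearMap.mem_ker, ← ιK_kdP]
  constructor
  · intro h
    exact ιK_injective (by rw [h, map_zero])
  · intro h
    rw [h, map_zero]

/-- The columns of the Koszul matrix are homogeneous: `∂ e_J` has entries `0` or `± x_i`, of degree
`(q + 1) - q = 1`. [cite: GortzWedhorn2023, (19.1) Def. 19.1] -/
theorem isHomog_kdP_single (q : ℕ) (J : Sub (Fin (r + 1)) (q + 1)) :
    IsHomog (fun _ : Sub (Fin (r + 1)) q => (q : ℤ)) ((q + 1 : ℕ) : ℤ)
      (kd (M := P ℂ r) (fun i : Fin (r + 1) => (MvPolynomial.X i : P ℂ r)) q (Pi.single J 1)) := by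
  classical
  rw [IsHomog, projDeg_eq_self_iff, mem_Kdeg]
  intro I
  rw [ιK_kdP, kd_apply]
  refine Submodule.sum_mem _ fun i _ => ?_
  have hdeg : ((q + 1 : ℕ) : ℤ) - (q : ℤ) = 1 + 0 := by push_cast; ring
  rw [hdeg, smul_eq_mul]
  refine mul_mem_Ldeg ?_ ?_
  · -- `ε · x_i ∈ L_1`
    have hs : OrderedCech.sign (L ℂ r) (insert i I.1) i ∈ Ldeg ℂ r 0 := by
      unfold OrderedCech.sign
      rcases neg_one_pow_eq_or (L ℂ r) ((insert i I.1).filter (· < i)).card with h1 | h1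
      · rw [h1, AddMonoidAlgebra.one_def]; exact single_mem_Ldeg (by simp) 1
      · rw [h1, AddMonoidAlgebra.one_def]
        exact Submodule.neg_mem _ (single_mem_Ldeg (by simp) 1)
    have := mul_mem_Ldeg hs (xL_mem_Ldeg i)
    rwa [zero_add] at this
  · -- the coordinate of `ι(e_J)` is `0` or `1`
    by_cases h : (insert i I.1).card = q + 1
    · rw [extL_apply_of_eq h, ιK_apply]
      by_cases hJ : (⟨insert i I.1, h⟩ : Sub (Fin (r + 1)) (q + 1)) = J
      · rw [hJ, Pi.single_eq_same, map_one, AddMonoidAlgebra.one_def]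
        exact single_mem_Ldeg (by simp) 1
      · rw [Pi.single_eq_of_ne hJ, map_zero]; exact Submodule.zero_mem _
    · rw [extL_apply_of_ne h]; exact Submodule.zero_mem _

/-- **The Koszul differential is graded of degree zero** (`LaurentCech.IsDegZero`).
[cite: GortzWedhorn2023, (19.1) Def. 19.1] -/
theorem isDegZero_kdP (q : ℕ) :
    IsDegZero (fun _ : Sub (Fin (r + 1)) q => (q : ℤ)) (fun _ : Sub (Fin (r + 1)) (q + 1) => ((q + 1 : ℕ) : ℤ))
      (kd (M := P ℂ r) (fun i : Fin (r + 1) => (MvPolynomial.X i : P ℂ r)) q) := by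
  classical
  exact isDegZero_of_isHomog _ _ _ fun J => isHomog_kdP_single q J

/-- **`Z_q` is a graded submodule of `P^{Sub q}`** (`Z_0 = P` is graded; `Z_{q+1}` is the kernel of a
degree-zero map, `LaurentCech.IsDegZero.isGraded_ker`). [cite: OkonekSchneiderSpindler1980, Ch. I §1.1 (3)] -/
theorem isGraded_Zsub (q : ℕ) : IsGraded (fun _ : Sub (Fin (r + 1)) q => (q : ℤ)) (Zsub r q) := by
  cases q with
  | zero => rw [Zsub_zero]; exact isGraded_top _
  | succ q =>
    rw [Zsub_succ]
    have := (isDegZero_kdP (r := r) q).isGraded_ker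
    simpa using this

/-! ### Serre's vanishing theorem for `Ω^p(n)`, algebraic and holomorphic -/

/-- **Serre's vanishing theorem for `Ω^p_{ℙ_r}(n)`, algebraic Čech form**: there is `n₀` such that
`Hᵃ(Č_n(Z_p)) = 0` for all `n ≥ n₀` and all `a ≥ 1` (the tree's graded-module Serre vanishing
`LaurentCech.exists_forall_isZero_homology_cech` applied to the graded module `Z_p`).
[cite: Hartshorne1977, III Thm. 5.2 (b)] -/
theorem exists_forall_isZero_homology_cech_Zsub (p : ℕ) :
    ∃ n₀ : ℤ, ∀ n, n₀ ≤ n → ∀ a : ℤ, 1 ≤ a →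
      IsZero ((LaurentCech.cech (fun _ : Sub (Fin (r + 1)) p => (p : ℤ)) (Zsub r p) n).homology a) :=
  exists_forall_isZero_homology_cech _ (isGraded_Zsub p)

/-- **Serre's vanishing theorem for `Ω^p_{ℙ_r}(n)^h`, holomorphic Čech form** (by GAGA): there is `n₀`
such that `Ȟᵃ(𝔘^h, Ω^p(n)^h) = 0` for all `n ≥ n₀` and all `a ≥ 1`.
[cite: Hartshorne1977, III Thm. 5.2 (b)] [cite: SerreGAGA1956, n° 12 Théorème 1] -/
theorem exists_forall_isZero_homology_holCech (p : ℕ) :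
    ∃ n₀ : ℤ, ∀ n, n₀ ≤ n → ∀ a : ℤ, 1 ≤ a → IsZero ((holCech r p n).homology a) := by
  obtain ⟨n₀, h⟩ := exists_forall_isZero_homology_cech_Zsub (r := r) p
  refine ⟨n₀, fun n hn a ha => ?_⟩
  haveI := isIso_homologyMap_cechComparison (r := r) p n a
  exact (h n hn a ha).of_iso (asIso (HomologicalComplex.homologyMap (cechComparison r p n) a)).symm

end GAGAForms

end Literature.AlgebraicGeometry.HodgeTheory
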